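import Literature.NumberTheory.EllipticCurves.SerreOpenImageDeterminantProofs
import Literature.NumberTheory.EllipticCurves.Isogeny
import Literature.NumberTheory.GaloisRepresentations.SerreCartanSubgroupsGL2Fp
import HarnessLib

/-!
# Balakrishnan–Dogra–Müller–Tuitman–Vonk 2019, Thm. 1.2: no non-CM elliptic curve over `ℚ` has
# mod-`p` image in the normaliser of a split Cartan subgroup for `p > 7`

HONEST FRAMING (cell `b2b-bsdres`, run/shared/lean/b2b/bsd-rank1-residual/): the cell deletes the
COMBINATION-SHAPED residual classes of the BSD formula in analytic rank `≤ 1` from PUBLISHED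
theorems only and TYPES the construction-shaped ones; this is not "finishing BSD".  This file
vendors ONE published theorem as a named fact (`def … : Prop`, nothing asserted; D-0014), in the
tree's Serre-1972 vocabulary (`GaloisRepresentations/SerreCartanSubgroupsGL2Fp`: `splitCartan P`
= `P (* 0; 0 *) P⁻¹`; frames `(e, Φ)` of `E[p]` as produced by
`WeierstrassCurve.exists_frame_galoisRepTorsion_rat`, `SerreOpenImageDeterminantProofs`).  It is
the classification input that confines the residual class X9 (irreducible, non-surjective image at
a good ORDINARY prime `p ≥ 5`) to `p ∈ {5, 7}` (`Rank1Residual/X9ImageShape.lean`: at a good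
ordinary `p ≥ 7` such an image normalises a split Cartan subgroup).

Source (read 2026-08-18: arXiv:1711.05846 = the Annals text, materialised `paper:arxiv-1711.05846`
p0003–p0004): J. S. Balakrishnan, N. Dogra, J. S. Müller, J. Tuitman, J. Vonk, *Explicit
Chabauty–Kim for the split Cartan modular curve of level 13*, Ann. of Math. (2) 189 (2019), no. 3,
885–944, doi:10.4007/annals.2019.189.3.6 [BalakrishnanEtAl2019] — PUBLISHED.  Verbatim (p. 2 of
the arXiv text, after Thm. 1.1 "The rational points on `X_s(13)` consist of six CM-points and one
cusp."):

> Together with the results of Bilu–Parent and Bilu–Parent–Rebolledo, this allows us to complete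
> the characterisation of all primes `ℓ` such that the mod-`ℓ` Galois representation of a non-CM
> elliptic curve over `ℚ` is contained in the normalizer of a split Cartan subgroup of `GL₂(𝔽_ℓ)`.
> **Theorem 1.2.** Let `ℓ` be a prime number. Then there exists an elliptic curve `E/ℚ` without CM
> such that the image of its mod-`ℓ` Galois representation is contained in the normalizer of a
> split Cartan subgroup of `GL₂(𝔽_ℓ)` if and only if `ℓ ≤ 7`.

The inputs of its proof for `ℓ ≥ 11`, `ℓ ≠ 13` are Bilu–Parent, Ann. of Math. 173 (2011) and
Bilu–Parent–Rebolledo, Ann. Inst. Fourier 63 (2013), Cor. 1.2 (read: arXiv:1104.4641 p. 4,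
verbatim: "Let `E` be an elliptic curve over `ℚ` without complex multiplication and `p` a prime
number, `p ≥ 11`, `p ≠ 13`. Then the image of the Galois representation
`ρ_{E,p} : Gal(ℚ̄/ℚ) → GL₂(𝔽_p)` is not contained in the normalizer of a split Cartan subgroup of
`GL₂(𝔽_p)`." [BiluParentRebolledo2013]); the case `ℓ = 13` ("the cursed level") is the paper's
Thm. 1.1 (quadratic Chabauty for `X_s(13)`, genus `3`, rank `3`).  All three are refereed journal
articles.

## What is vendored

* `thm12_not_le_normalizer_splitCartan` — the "only if" half of Thm. 1.2, i.e. its content for the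
  arithmetic of a GIVEN curve: for `E/ℚ` without CM and a prime `p > 7`, the image of `ρ̄_{E,p}`
  is not contained in the normaliser of a split Cartan subgroup of `GL₂(𝔽_p)`.  Transcription:
  "without CM" = `¬ W.HasCM` (geometric CM, `Isogeny.lean` — the paper's "non-CM"); the image is
  `Φ(ρ̄_{E,p}(Γ_ℚ)) = (galoisRepTorsion W p).range.map Φ` for a frame `(e, Φ)` of `E[p]`
  (an additive isomorphism `e : E[p] ≃ 𝔽_p²` and the induced `Φ : Aut(E[p]) ≅ GL₂(𝔽_p)`,
  `e(g x) = Φ(g) e(x)`); "contained in the normalizer of a split Cartan subgroup" =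
  `≤ N(splitCartan P)` for some `P ∈ GL₂(𝔽_p)`.  The statement is made for EVERY frame: two frames
  differ by conjugation by an element of `GL₂(𝔽_p)`, which permutes the split Cartan subgroups,
  so "for every frame" and "for some frame" both say exactly what is printed.
* NOT vendored: the "if" half (existence of non-CM examples at `ℓ ≤ 7` — Zywina's explicit
  families, not needed by the cell), Thm. 1.1 itself (rational points of `X_s(13)`: no tree
  vocabulary for the modular curve `X_s(p)` and its moduli interpretation), Cor. 1.3
  (`X_ns(13)(ℚ)`).
  -- TODO(general form): Thm. 1.1 (`X_s(13)(ℚ)` = six CM points and one cusp) and the moduli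
  -- dictionary "image ⊆ N(C_s(p)) ⟺ non-cuspidal point of X_s(p)(ℚ)", once modular curves of
  -- Cartan level are in the tree.

No `_holds` (quadratic Chabauty / Chabauty–Kim, the Gross-vectors sieve of Bilu–Parent–Rebolledo
and Bilu–Parent's Runge-type bounds are far from Mathlib); consumers take
`(hBDMTV : thm12_not_le_normalizer_splitCartan)`.
-/

noncomputable section

open scoped MatrixGroups
open Matrix Field WeierstrassCurve
open Literature.NumberTheory.GaloisRepresentations
  Literature.NumberTheory.GaloisRepresentations.Serre1972

namespace Literature.NumberTheory.EllipticCurves.BalakrishnanEtAl2019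

/-- **Balakrishnan–Dogra–Müller–Tuitman–Vonk, Ann. of Math. 189 (2019), Thm. 1.2 ("only if"
half)** — verbatim (arXiv:1711.05846 p. 2): "Let `ℓ` be a prime number. Then there exists an
elliptic curve `E/ℚ` without CM such that the image of its mod-`ℓ` Galois representation is
contained in the normalizer of a split Cartan subgroup of `GL₂(𝔽_ℓ)` if and only if `ℓ ≤ 7`."
(For `ℓ ≥ 11`, `ℓ ≠ 13` this is Bilu–Parent–Rebolledo, Ann. Inst. Fourier 63 (2013), Cor. 1.2;
for `ℓ = 13` it is the paper's Thm. 1.1, `X_s(13)(ℚ)` = six CM points and one cusp.)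
Transcription of the "only if" half: for every elliptic curve `E = W/ℚ` WITHOUT (geometric)
complex multiplication (`¬ W.HasCM`), every prime `p` with `7 < p`, every frame `(e, Φ)` of
`E[p]` (`e : E[p] ≃+ 𝔽_p²`, `Φ : Aut(E[p]) ≃* GL₂(𝔽_p)`, `e (g x) = Φ(g) e(x)`) and every
`P ∈ GL₂(𝔽_p)`, the image `Φ(ρ̄_{E,p}(Γ_ℚ))` is NOT contained in the normaliser of the split
Cartan subgroup `P (* 0; 0 *) P⁻¹` (`splitCartan P`; every split Cartan subgroup of `GL₂(𝔽_p)` is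
of this form, Serre 1972 §2.1 a).  Quantifying over all frames is harmless (frames are conjugate;
conjugation permutes split Cartan subgroups).  Size XL; no `_holds`.
[cite: BalakrishnanEtAl2019, §1 Thm. 1.2 (arXiv:1711.05846 p. 2)] -/
def thm12_not_le_normalizer_splitCartan : Prop :=
  ∀ (W : WeierstrassCurve ℚ) [W.IsElliptic] (p : ℕ) [Fact p.Prime], ¬ W.HasCM → 7 < p →
    ∀ (Φ : Multiplicative (AddAut (geomTorsion W p)) ≃* GL (Fin 2) (ZMod p))
      (e : geomTorsion W p ≃+ (Fin 2 → ZMod p)),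
      (∀ (g : Multiplicative (AddAut (geomTorsion W p))) (x : geomTorsion W p),
        e (Multiplicative.toAdd g x) =
          ((Φ g : GL (Fin 2) (ZMod p)) : Matrix (Fin 2) (Fin 2) (ZMod p)) *ᵥ e x) →
    ∀ P : GL (Fin 2) (ZMod p),
      ¬ (galoisRepTorsion W p).range.map Φ.toMonoidHom ≤
          Subgroup.normalizer (splitCartan P : Set (GL (Fin 2) (ZMod p)))

end Literature.NumberTheory.EllipticCurves.BalakrishnanEtAl2019

end
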